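import Summits.QuantumFields.QCD.Theses.PauliWegnerSea
import Literature.MathematicalPhysics.QuantumFieldTheory.QCDPhaseQuenched
import Literature.MathematicalPhysics.QuantumFieldTheory.QCDWickMinorMeasurability
import Summits.QuantumFields.QCD.Theorems.PauliWegnerSeaOneScaleTrajectoryStubAdjugateBandLimit
import Summits.QuantumFields.QCD.Theorems.PauliWegnerSeaOneScaleTrajectoryStubAdjugateSmallBall
import Summits.QuantumFields.QCD.Theorems.PauliWegnerSeaOneScaleTrajectoryStubResampling
import Summits.QuantumFields.QCD.Theorems.PauliWegnerSeaOneScaleTrajectoryStubFibreDominate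
import Summits.QuantumFields.QCD.Theorems.PauliWegnerSeaOneScaleTrajectoryStubPowerMeanSandwich
import HarnessLib.Audit

/-!
# Line `adjugate-anticoncentration-pin` for crux `PauliWegnerSea.OneScaleTrajectory`
# (stmt-QuantumFields-11513; rank 5 of route-QuantumFields-PauliWegnerSea) — LEAD'S RESHAPE (c1)

Planner's skeleton: `Cruxes/OneScaleTrajectory/Lines/adjugate_anticoncentration_pin.lean` (crux-plan round 1,
4 stubs A–D).  This file is the lead's (prover-line-stmt-QuantumFields-11513-c1-0, 2026-08-16) reshape:

* every LANDABLE stub is restated in TREE VOCABULARY ONLY (no line-local definition in a registered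
  signature), so that a worker's `Theorems/PauliWegnerSeaOneScaleTrajectory<Stub>.lean` can state it verbatim
  without a `Defs` file (same device as the threshold line's `stub_heavyDecay`);
* the planner's size-L `stub_fibreDelocalisation` is SPLIT at the skeleton level into the two modules it is
  made of — `stub_resampling` (the DLR / heat-bath resampling identity of the torus Wilson state on an
  arbitrary link set: tree `isGibbsMeasure_wilsonMeasure`) and `stub_fibreDominate` (the fibrewise
  domination `E_ν[|det D| X_f^{-r}] ≤ C(1+β)^P 𝒮_f^{-r} E_ν[|det D|]` from the adjugate small balls and the
  PROVED route item `TiltedFlatness`, stmt-14070) — plus the lead's own assembly stub `stub_fibreGlue`;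
* `TiltedFlatness` is no longer a hypothesis of the composition: it is PROVED
  (`Summit.QuantumFields.QCD.Theorems.CircleTransport.TiltedFlatness_proof`) and is consumed inside the proof
  of `stub_fibreDominate`, whose statement does not mention it;
* `Admissible` drops its clause (c) (one invertible configuration per torus): positivity of
  `∫ |det D| dμ_W` holds at EVERY parameter (tree `integral_norm_det_diracMatrix_pos_all`).

Registered stubs (history: 7; now 1 open): `stub_harmonicTrajectory` (A, physics, HARDEST — the lead's), `stub_adjugateSmallBall`
(B), `stub_adjugateBandLimit` (B-aux, LANDED p98614), `stub_resampling` (C1), `stub_fibreDominate` (C2), `stub_fibreGlue` (C-glue, the lead's),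
`stub_powerMeanSandwich` (D).  `OneScaleTrajectory_of` concludes the crux BY NAME from the six and nothing else.

## The line in one paragraph (unchanged)

Clause (iii) — `c₀ e^{-C₁ a_k n}(n+1)^{-p} ≤ E₊[X_f(n)^s]`, `X_f(n) = Σ_{a,i,b,j}|G_f(0, n e₀)_{ai,bj}|`, the crux's
only LOWER bound — is cut BY DISTANCE at `n + 1 ≶ (1+|β_k|)^κ` into the UV honesty pin `UVPin` (inside stub A)
and the far pin `FarPin`; the far pin follows by Lyapunov (`E₊[X^s] ≥ (E₊[X^{-r}])^{-s/r}`, stub D) from an upper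
bound on a NEGATIVE moment (`HarmonicPin`), which the band-limited ADJUGATE (`X_f = A_f/|det D_f|` off the
walls; relative small balls on the two-star fibre, stub B) delocalises onto the fibre-smoothed, outside-only scale
`𝒮_f = ⟨A_f⟩_fibre/⟨|det D_f|⟩_fibre` (stubs C1, C2, C-glue); what is left is `NoDeepFades` of `𝒮_f` plus the
companion clauses, in ONE existential physics stub (A).

## Disproof.lean / negatives honoured

As in the planner's skeleton (cdisprove cycle 1, v1–v5, read through its evidence notes — `run/gate` is not
mounted in this jail and the crux directory holds no `Disproof.lean`): `tendsto_beta_atTop` is the reason for the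
distance split; the one-scale clause is carried VERBATIM in stub A (log room, `1 ≤ ℓ₀`:
`not_OneScaleTrajectoryPhysicalShell`, `oneScale_of_shell_zero`, `skeleton_consistent`);
`eventually_mcrit_lt_of_clauseIII` is reproduced by `UVPin`; `clauseIV_of_bareMass_pos` — (iv) untouched; no
`_false_without_<H>` theorem and no landed `Theorems/OneScaleTrajectory/Negative/*` exist (2026-08-16).
-/

open scoped BigOperators ENNReal
open MeasureTheory Filter
open Literature.MathematicalPhysics.QuantumFieldTheory Literature.MathematicalPhysics.QuantumLattice
  Literature.Probability.LatticeModels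

noncomputable section

namespace Summit.QuantumFields.QCD.Cruxes.OneScaleTrajectory.AdjugateAnticoncentrationPin

/-! ### §0a Vocabulary (local abbreviations; NO registered signature mentions them) -/

section Vocabulary

variable {Nf : ℕ}

/-- The crux's bare-mass trajectory `m_f(k) = m_crit(k) + a_k m_f / Z_m(k)`. -/
abbrev bare (reg : QCDRegularisation Nf) (m : Fin Nf → ℝ) (k : ℕ) : Fin Nf → ℝ :=
  fun fl => reg.mcrit k + reg.a k * m fl / reg.Zm k

/-- `X_f(x,y)`: the colour–spin ℓ¹ block of the flavour-`f` quark propagator `(diracMatrix U mq)⁻¹`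
between the torus sites `x` and `y` (Mathlib `Matrix.inv`, junk `0` on the walls `{det D = 0}`). -/
def propBlock {N : ℕ} [NeZero N] (U : GaugeConfig 4 N SU3) (mq : Fin Nf → ℝ) (f : Fin Nf)
    (x y : TorusSite 4 N) : ℝ :=
  ∑ a : Fin 3, ∑ i : Fin 4, ∑ b : Fin 3, ∑ j : Fin 4,
    ‖(diracMatrix U mq)⁻¹ (quarkEquiv (f, (x, a, i))) (quarkEquiv (f, (y, b, j)))‖

/-- `E₊[X_f(0, n e₀)^s]` at step `k`, torus side `2S+1` — literally the quotient of clause (iii). -/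
def pqMoment (reg : QCDRegularisation Nf) (m : Fin Nf → ℝ) (k S : ℕ) (f : Fin Nf) (n : ℕ) (s : ℝ) : ℝ :=
  (∫ U : GaugeConfig 4 (2 * S + 1) (Matrix.specialUnitaryGroup (Fin 3) ℂ), ‖(diracMatrix U fun fl => reg.mcrit k + reg.a k * m fl / reg.Zm k).det‖ * (∑ a : Fin 3, ∑ i : Fin 4, ∑ b : Fin 3, ∑ j : Fin 4, ‖(diracMatrix U fun fl => reg.mcrit k + reg.a k * m fl / reg.Zm k)⁻¹ (quarkEquiv (f, (Torus.proj (2 * S + 1) 0, a, i))) (quarkEquiv (f, (Torus.proj (2 * S + 1) (Pi.single 0 (n : ℤ)), b, j)))‖) ^ s ∂(wilsonMeasure (fundamentalRep (Fin 3)) (reg.β k))) / (∫ U : GaugeConfig 4 (2 * S + 1) (Matrix.specialUnitaryGroup (Fin 3) ℂ), ‖(diracMatrix U fun fl => reg.mcrit k + reg.a k * m fl / reg.Zm k).det‖ ∂(wilsonMeasure (fundamentalRep (Fin 3)) (reg.β k)))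

/-- `∫ |det D| dμ_W` at step `k`, side `2S+1`, as a lower Lebesgue integral. -/
def pqWeight (reg : QCDRegularisation Nf) (m : Fin Nf → ℝ) (k S : ℕ) : ℝ≥0∞ :=
  ∫⁻ U : GaugeConfig 4 (2 * S + 1) SU3,
    ENNReal.ofReal ‖(diracMatrix U fun fl => reg.mcrit k + reg.a k * m fl / reg.Zm k).det‖
    ∂(wilsonMeasure (fundamentalRep (Fin 3)) (reg.β k))

/-- `∫ |det D| · X_f(0, n e₀)^{-r} dμ_W` as a LOWER LEBESGUE integral in `ℝ≥0∞` (`ofReal 0 ^ (-r) = ⊤`: a dead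
channel off the walls shows as `⊤`; on the walls `ofReal 0 * ⊤ = 0`). -/
def pqHarmonic (reg : QCDRegularisation Nf) (m : Fin Nf → ℝ) (k S : ℕ) (f : Fin Nf) (n : ℕ) (r : ℝ) : ℝ≥0∞ :=
  ∫⁻ U : GaugeConfig 4 (2 * S + 1) SU3,
    ENNReal.ofReal ‖(diracMatrix U fun fl => reg.mcrit k + reg.a k * m fl / reg.Zm k).det‖ *
      ENNReal.ofReal (∑ a : Fin 3, ∑ i : Fin 4, ∑ b : Fin 3, ∑ j : Fin 4,
        ‖(diracMatrix U fun fl => reg.mcrit k + reg.a k * m fl / reg.Zm k)⁻¹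
          (quarkEquiv (f, (Torus.proj (2 * S + 1) 0, a, i)))
          (quarkEquiv (f, (Torus.proj (2 * S + 1) (Pi.single 0 (n : ℤ)), b, j)))‖) ^ (-r)
    ∂(wilsonMeasure (fundamentalRep (Fin 3)) (reg.β k))

/-! Two-star fibre objects (the route's `star` / `refit` / tilted law, as local definitions). -/

/-- `refit`: the links of `star(x) ∪ star(y)` of `U` replaced by those of `W`, the outside kept.  The star
condition is written as the syntactic disjunction of the route text (decidable by the canonical instances). -/
def refit {N : ℕ} (x y : TorusSite 4 N) (U W : GaugeConfig 4 N SU3) : GaugeConfig 4 N SU3 :=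
  fun e => if e.1 = x ∨ Site.shift e.1 e.2 = x ∨ e.1 = y ∨ Site.shift e.1 e.2 = y then W e else U e

/-- Product Haar on all links of the torus of side `N`. -/
def haarCfg (N : ℕ) [NeZero N] : Measure (GaugeConfig 4 N SU3) := Measure.pi fun _ => haarProbability SU3

/-- The tilted fibre weight `exp(-β S_W(refit_U W))`. -/
def fibreWt (β : ℝ) {N : ℕ} [NeZero N] (x y : TorusSite 4 N) (U W : GaugeConfig 4 N SU3) : ℝ :=
  Real.exp (-(β * wilsonAction (fundamentalRep (Fin 3)) (refit x y U W)))

/-- The mean of an amplitude `Φ ∘ refit` under the two-star conditional law given the outside of `U`. -/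
def tMean (β : ℝ) {N : ℕ} [NeZero N] (x y : TorusSite 4 N) (U : GaugeConfig 4 N SU3)
    (Φ : GaugeConfig 4 N SU3 → ℝ) : ℝ :=
  (∫ W, Φ (refit x y U W) * fibreWt β x y U W ∂(haarCfg N)) / ∫ W, fibreWt β x y U W ∂(haarCfg N)

/-- `A(V; m₀, x, y)`: the ℓ¹ colour–spin `(x,y)` block of the ADJUGATE of the one-flavour `r = 1` Wilson–Dirac
matrix. -/
def adjBlock {N : ℕ} [NeZero N] (V : GaugeConfig 4 N SU3) (m₀ : ℝ) (x y : TorusSite 4 N) : ℝ :=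
  ∑ a : Fin 3, ∑ i : Fin 4, ∑ b : Fin 3, ∑ j : Fin 4,
    ‖(wilsonDirac (fundamentalRep (Fin 3)) V m₀ 1).adjugate (x, a, i) (y, b, j)‖

/-- `|det D_W(V; m₀, r = 1)|`, one flavour. -/
def detAbs {N : ℕ} [NeZero N] (V : GaugeConfig 4 N SU3) (m₀ : ℝ) : ℝ :=
  ‖(wilsonDirac (fundamentalRep (Fin 3)) V m₀ 1).det‖

/-- **The fibre-smoothed scale** `𝒮 = ⟨A⟩_fibre / ⟨|det D_f|⟩_fibre` (a function of the OUTSIDE of `U` only). -/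
def fibreScale (β : ℝ) {N : ℕ} [NeZero N] (U : GaugeConfig 4 N SU3) (m₀ : ℝ) (x y : TorusSite 4 N) : ℝ :=
  tMean β x y U (fun V => adjBlock V m₀ x y) / tMean β x y U (fun V => detAbs V m₀)

/-- `∫ |det D| · 𝒮_f(0, n e₀)^{-r} dμ_W` in `ℝ≥0∞`. -/
def pqFibreHarmonic (reg : QCDRegularisation Nf) (m : Fin Nf → ℝ) (k S : ℕ) (f : Fin Nf) (n : ℕ) (r : ℝ) :
    ℝ≥0∞ :=
  ∫⁻ U : GaugeConfig 4 (2 * S + 1) SU3,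
    ENNReal.ofReal ‖(diracMatrix U (bare reg m k)).det‖ *
      ENNReal.ofReal (fibreScale (reg.β k) U (bare reg m k f) (Torus.proj (2 * S + 1) 0)
        (Torus.proj (2 * S + 1) (Pi.single 0 (n : ℤ)))) ^ (-r)
    ∂(wilsonMeasure (fundamentalRep (Fin 3)) (reg.β k))

/-- The packaged moment IS the tree's phase-quenched expectation `⟨X_f(0, n e₀)^s⟩₊`. -/
theorem pqMoment_eq (reg : QCDRegularisation Nf) (m : Fin Nf → ℝ) (k S : ℕ) (f : Fin Nf) (n : ℕ) (s : ℝ) :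
    pqMoment reg m k S f n s = qcdPhaseQuenchedExpect (reg.β k) (2 * S + 1) (bare reg m k)
      (fun U => propBlock U (bare reg m k) f (Torus.proj (2 * S + 1) 0)
        (Torus.proj (2 * S + 1) (Pi.single 0 (n : ℤ))) ^ s) := by
  rw [qcdPhaseQuenchedExpect_eq_div]
  rfl

end Vocabulary

/-! ### §0b Packaging of the crux (verbatim clause texts) -/

section Packaging

variable {Nf : ℕ}

/-- Clause (i) of the crux for `(reg, m)`, verbatim. -/
def ClauseI (reg : QCDRegularisation Nf) (m : Fin Nf → ℝ) : Prop :=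
  ∀ f : Fin Nf, ∀ᶠ k in atTop, -1 < reg.mcrit k + reg.a k * m f / reg.Zm k

/-- The one-scale clause of the crux for `(reg, m)`, verbatim (log room and `1 ≤ ℓ₀` kept). -/
def OneScale (reg : QCDRegularisation Nf) (m : Fin Nf → ℝ) : Prop :=
  ∀ q : ℕ, ∃ K₀ s : ℝ, 0 < s ∧ s < 1 ∧ ∀ᶠ k in atTop, ∃ ℓ₀ : ℕ, 1 ≤ ℓ₀ ∧ ℓ₀ ≤ reg.L k ∧ (ℓ₀ : ℝ) * reg.a k ≤ K₀ * (1 + |Real.log (reg.a k)|) ∧ ∀ S : ℕ, reg.L k ≤ S → ∀ (f : Fin Nf) (v : Literature.Probability.LatticeModels.Site 4), v ∈ box 4 S → ‖v‖ = (ℓ₀ : ℝ) → (ℓ₀ : ℝ) ^ q * (1 + |reg.β k|) ^ q * ((∫ U : GaugeConfig 4 (2 * S + 1) (Matrix.specialUnitaryGroup (Fin 3) ℂ), ‖(diracMatrix U fun fl => reg.mcrit k + reg.a k * m fl / reg.Zm k).det‖ * (∑ a : Fin 3, ∑ i : Fin 4, ∑ b : Fin 3, ∑ j : Fin 4, ‖(diracMatrix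 U fun fl => reg.mcrit k + reg.a k * m fl / reg.Zm k)⁻¹ (quarkEquiv (f, (Torus.proj (2 * S + 1) 0, a, i))) (quarkEquiv (f, (Torus.proj (2 * S + 1) (v), b, j)))‖) ^ s ∂(wilsonMeasure (fundamentalRep (Fin 3)) (reg.β k))) / (∫ U : GaugeConfig 4 (2 * S + 1) (Matrix.specialUnitaryGroup (Fin 3) ℂ), ‖(diracMatrix U fun fl => reg.mcrit k + reg.a k * m fl / reg.Zm k).det‖ ∂(wilsonMeasure (fundamentalRep (Fin 3)) (reg.β k)))) ≤ 1

/-- Clause (iii) of the crux for `(reg, m)`, verbatim. -/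
def ClauseIII (reg : QCDRegularisation Nf) (m : Fin Nf → ℝ) : Prop :=
  ∃ s c₀ C₁ p : ℝ, 0 < s ∧ s < 1 ∧ 0 < c₀ ∧ ∀ᶠ k in atTop, ∀ S : ℕ, reg.L k ≤ S → ∀ (f : Fin Nf) (n : ℕ), n ≤ S → c₀ * Real.exp (-(C₁ * (reg.a k * n) + p * Real.log (n + 1))) ≤ (∫ U : GaugeConfig 4 (2 * S + 1) (Matrix.specialUnitaryGroup (Fin 3) ℂ), ‖(diracMatrix U fun fl => reg.mcrit k + reg.a k * m fl / reg.Zm k).det‖ * (∑ a : Fin 3, ∑ i : Fin 4, ∑ b : Fin 3, ∑ j : Fin 4, ‖(diracMatrix U fun fl => reg.mcrit k + reg.a k * m fl / reg.Zm k)⁻¹ (quarkEquiv (f, (Torus.proj (2 * S + 1) 0, a, i))) (quarkEquiv (f, (Torus.proj (2 * S + 1) (Pi.single 0 (n : ℤ)), b, j)))‖) ^ s ∂(wilsonMeasure (fundamentalRep (Fin 3)) (reg.β k))) / (∫ U : GaugeConfig 4 (2 * S + 1) (Matrix.specialUnitaryGroup (Fin 3) ℂ), ‖(diracMatrix U fun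 fl => reg.mcrit k + reg.a k * m fl / reg.Zm k).det‖ ∂(wilsonMeasure (fundamentalRep (Fin 3)) (reg.β k)))

/-- Clause (iv) of the crux for `(reg, m)`, verbatim. -/
def ClauseIV (reg : QCDRegularisation Nf) (m : Fin Nf → ℝ) : Prop :=
  ∀ᶠ k in atTop, (1 / 2 : ℝ) ≤ ‖∫ U : GaugeConfig 4 (2 * reg.L k + 1) (Matrix.specialUnitaryGroup (Fin 3) ℂ), (diracMatrix U fun fl => reg.mcrit k + reg.a k * m fl / reg.Zm k).det ∂(wilsonMeasure (fundamentalRep (Fin 3)) (reg.β k))‖ / (∫ U : GaugeConfig 4 (2 * reg.L k + 1) (Matrix.specialUnitaryGroup (Fin 3) ℂ), ‖(diracMatrix U fun fl => reg.mcrit k + reg.a k * m fl / reg.Zm k).det‖ ∂(wilsonMeasure (fundamentalRep (Fin 3)) (reg.β k)))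

/-- The crux re-read through the packaging (definitional). -/
theorem crux_iff :
    Summit.QuantumFields.QCD.Theses.PauliWegnerSea.OneScaleTrajectory ↔
      ∀ Nf : ℕ, Nf = 2 ∨ Nf = 3 → ∃ reg : QCDRegularisation Nf, reg.HasMassScaling ∧
        (reg.scheme 0 0 0).HasAsymptoticScaling ∧ ∀ m : Fin Nf → ℝ, (∀ f, 0 < m f) →
          ClauseI reg m ∧ OneScale reg m ∧ ClauseIII reg m ∧ ClauseIV reg m :=
  Iff.rfl

end Packaging

/-! ### §0c The intermediate statements of the line -/

section LineProps

variable {Nf : ℕ}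

/-- **ADMISSIBLE** (bookkeeping of the witness, consumed by the fibre step): (a) `0 ≤ β_k` eventually (free under
asymptotic scaling, Disproof `tendsto_beta_atTop`); (b) bare masses eventually in `[-2, 2]` (the mass range of
`TiltedFlatness` / the adjugate small balls).  (The planner's clause (c) is dropped: `∫|det D| dμ_W > 0` at every
parameter, tree `integral_norm_det_diracMatrix_pos_all`.) -/
def Admissible (reg : QCDRegularisation Nf) (m : Fin Nf → ℝ) : Prop :=
  (∀ᶠ k in atTop, 0 ≤ reg.β k) ∧
    ∀ f : Fin Nf, ∀ᶠ k in atTop, -2 ≤ bare reg m k f ∧ bare reg m k f ≤ 2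

/-- **UV HONESTY PIN** (the near half of (iii)): the lower bound of clause (iii) on `n + 1 < (1 + |β_k|)^κ`. -/
def UVPin (reg : QCDRegularisation Nf) (m : Fin Nf → ℝ) : Prop :=
  ∃ κ s c₀ C₁ p : ℝ, 0 < κ ∧ 0 < s ∧ s < 1 ∧ 0 < c₀ ∧ ∀ᶠ k in atTop, ∀ S : ℕ, reg.L k ≤ S →
    ∀ (f : Fin Nf) (n : ℕ), n ≤ S → (n : ℝ) + 1 < (1 + |reg.β k|) ^ κ →
      c₀ * Real.exp (-(C₁ * (reg.a k * n) + p * Real.log (n + 1))) ≤ pqMoment reg m k S f n s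

/-- **FAR PIN** (the far half of (iii)): for EVERY `κ > 0`, `s ∈ (0,1)`, the lower bound on `(1+|β_k|)^κ ≤ n+1`. -/
def FarPin (reg : QCDRegularisation Nf) (m : Fin Nf → ℝ) : Prop :=
  ∀ κ s : ℝ, 0 < κ → 0 < s → s < 1 → ∃ c₀ C₁ p : ℝ, 0 < c₀ ∧ ∀ᶠ k in atTop, ∀ S : ℕ, reg.L k ≤ S →
    ∀ (f : Fin Nf) (n : ℕ), n ≤ S → (1 + |reg.β k|) ^ κ ≤ (n : ℝ) + 1 →
      c₀ * Real.exp (-(C₁ * (reg.a k * n) + p * Real.log (n + 1))) ≤ pqMoment reg m k S f n s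

/-- **HARMONIC PIN**: `E₊[X_f(n)^{-r}] ≤ c (1+|β_k|)^P e^{r(C₁ a_k n + p log(n+1))}` (lintegral form). -/
def HarmonicPin (reg : QCDRegularisation Nf) (m : Fin Nf → ℝ) : Prop :=
  ∃ r P c C₁ p : ℝ, 0 < r ∧ 0 < c ∧ ∀ᶠ k in atTop, ∀ S : ℕ, reg.L k ≤ S → ∀ (f : Fin Nf) (n : ℕ), n ≤ S →
    pqHarmonic reg m k S f n r ≤
      ENNReal.ofReal (c * (1 + |reg.β k|) ^ P * Real.exp (r * (C₁ * (reg.a k * n) + p * Real.log (n + 1)))) *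
        pqWeight reg m k S

/-- **NO DEEP FADES** (the physics of the far pin): for all small `r > 0`,
`E₊[𝒮_f(0, n e₀)^{-r}] ≤ c e^{r(C₁ a_k n + p log(n+1))}` eventually, for all `S ≥ L_k`, `f`, `n ≤ S`. -/
def NoDeepFades (reg : QCDRegularisation Nf) (m : Fin Nf → ℝ) : Prop :=
  ∃ r₀ : ℝ, 0 < r₀ ∧ ∀ r : ℝ, 0 < r → r ≤ r₀ → ∃ c C₁ p : ℝ, 0 < c ∧ ∀ᶠ k in atTop, ∀ S : ℕ, reg.L k ≤ S →
    ∀ (f : Fin Nf) (n : ℕ), n ≤ S →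
      pqFibreHarmonic reg m k S f n r ≤
        ENNReal.ofReal (c * Real.exp (r * (C₁ * (reg.a k * n) + p * Real.log (n + 1)))) * pqWeight reg m k S

end LineProps

/-! ### §0d The landable module statements, in TREE VOCABULARY (each is the text of a registered stub) -/

namespace Registered

/-- Text of `stub_adjugateSmallBall` (B): tilted, guarded, `(1+β)^p`-lossy relative small balls for the ℓ¹
adjugate block of the one-flavour Wilson–Dirac matrix on the two-star fibre. -/
abbrev stub_adjugateSmallBall : Prop :=
  ∃ C p c : ℝ, 0 < C ∧ 0 < c ∧ ∀ β : ℝ, 0 ≤ β → ∀ m₀ : ℝ, -2 ≤ m₀ → m₀ ≤ 2 →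
    ∀ (N : ℕ) [NeZero N], 4 ≤ N → ∀ (U : GaugeConfig 4 N SU3) (x y : TorusSite 4 N)
      (refit : GaugeConfig 4 N SU3 → GaugeConfig 4 N SU3),
      (∀ W e, refit W e = if e.1 = x ∨ Site.shift e.1 e.2 = x ∨ e.1 = y ∨ Site.shift e.1 e.2 = y then W e else U e) →
      ∀ (A wt : GaugeConfig 4 N SU3 → ℝ),
        (∀ W, A W = ∑ a : Fin 3, ∑ i : Fin 4, ∑ b : Fin 3, ∑ j : Fin 4,
          ‖(wilsonDirac (fundamentalRep (Fin 3)) (refit W) m₀ 1).adjugate (x, a, i) (y, b, j)‖) →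
        (∀ W, wt W = Real.exp (-(β * wilsonAction (fundamentalRep (Fin 3)) (refit W)))) →
        ∀ (haar : Measure (GaugeConfig 4 N SU3)), haar = Measure.pi (fun _ => haarProbability SU3) →
        ∀ (M : ℝ), M = (∫ W, A W * wt W ∂haar) / ∫ W, wt W ∂haar → 0 < M → ∀ ε : ℝ, 0 < ε →
          (∫ W, (if A W ≤ ε * M then (1 : ℝ) else 0) * wt W ∂haar) / (∫ W, wt W ∂haar) ≤
            C * (1 + β) ^ p * ε ^ c

/-- Text of `stub_resampling` (C1): the heat-bath resampling (DLR) identity of the torus Wilson state on an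
arbitrary decidable link set `P` — integrating `Φ` against `μ_W` equals integrating its tilted fibre mean. -/
abbrev stub_resampling : Prop :=
  ∀ (N : ℕ) [NeZero N] (β : ℝ) (P : Edge 4 N → Prop) [DecidablePred P] (Φ : GaugeConfig 4 N SU3 → ℝ≥0∞),
    Measurable Φ →
      ∫⁻ U, Φ U ∂(wilsonMeasure (fundamentalRep (Fin 3)) β) =
        ∫⁻ U, (∫⁻ W, Φ (fun e => if P e then W e else U e) *
              ENNReal.ofReal (Real.exp (-(β * wilsonAction (fundamentalRep (Fin 3))
                (fun e => if P e then W e else U e))))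
              ∂(Measure.pi fun _ : Edge 4 N => haarProbability SU3)) /
            (∫⁻ W, ENNReal.ofReal (Real.exp (-(β * wilsonAction (fundamentalRep (Fin 3))
                (fun e => if P e then W e else U e))))
              ∂(Measure.pi fun _ : Edge 4 N => haarProbability SU3))
          ∂(wilsonMeasure (fundamentalRep (Fin 3)) β)

/-- Text of `stub_fibreDominate` (C2): on every two-star fibre, the tilted mean of `|det D| · X_f^{-r}` is at most
`C(1+β)^P 𝒮_f^{-r}` times the tilted mean of `|det D|`, given the adjugate small balls (B, as hypothesis). -/
abbrev stub_fibreDominate : Prop :=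
  stub_adjugateSmallBall →
    ∀ Nf : ℕ, ∃ r₁ : ℝ, 0 < r₁ ∧ ∀ r : ℝ, 0 < r → r ≤ r₁ → ∃ C P : ℝ, 0 < C ∧
      ∀ β : ℝ, 0 ≤ β → ∀ mq : Fin Nf → ℝ, (∀ g, -2 ≤ mq g ∧ mq g ≤ 2) →
        ∀ (N : ℕ) [NeZero N], 4 ≤ N → ∀ (U : GaugeConfig 4 N SU3) (x y : TorusSite 4 N) (f : Fin Nf)
          (refit : GaugeConfig 4 N SU3 → GaugeConfig 4 N SU3),
          (∀ W e, refit W e = if e.1 = x ∨ Site.shift e.1 e.2 = x ∨ e.1 = y ∨ Site.shift e.1 e.2 = y then W e else U e) →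
          ∀ (wt : GaugeConfig 4 N SU3 → ℝ),
            (∀ W, wt W = Real.exp (-(β * wilsonAction (fundamentalRep (Fin 3)) (refit W)))) →
            ∀ (haar : Measure (GaugeConfig 4 N SU3)), haar = Measure.pi (fun _ => haarProbability SU3) →
              ∫⁻ W, ENNReal.ofReal ‖(diracMatrix (refit W) mq).det‖ *
                  ENNReal.ofReal (∑ a : Fin 3, ∑ i : Fin 4, ∑ b : Fin 3, ∑ j : Fin 4,
                    ‖(diracMatrix (refit W) mq)⁻¹ (quarkEquiv (f, (x, a, i))) (quarkEquiv (f, (y, b, j)))‖) ^ (-r) *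
                  ENNReal.ofReal (wt W) ∂haar ≤
                ENNReal.ofReal (C * (1 + β) ^ P) *
                  ENNReal.ofReal (((∫ W, (∑ a : Fin 3, ∑ i : Fin 4, ∑ b : Fin 3, ∑ j : Fin 4,
                      ‖(wilsonDirac (fundamentalRep (Fin 3)) (refit W) (mq f) 1).adjugate (x, a, i) (y, b, j)‖) * wt W ∂haar) /
                      ∫ W, wt W ∂haar) /
                    ((∫ W, ‖(wilsonDirac (fundamentalRep (Fin 3)) (refit W) (mq f) 1).det‖ * wt W ∂haar) /
                      ∫ W, wt W ∂haar)) ^ (-r) *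
                  ∫⁻ W, ENNReal.ofReal ‖(diracMatrix (refit W) mq).det‖ * ENNReal.ofReal (wt W) ∂haar

/-- Text of `stub_powerMeanSandwich` (D): the harmonic pin implies the far pin (Lyapunov / power means, with
the polynomial `β`-loss absorbed by the window `(1+|β_k|)^κ ≤ n+1`). -/
abbrev stub_powerMeanSandwich : Prop :=
  ∀ (Nf : ℕ) (reg : QCDRegularisation Nf) (m : Fin Nf → ℝ),
    (∃ r P c C₁ p : ℝ, 0 < r ∧ 0 < c ∧ ∀ᶠ k in atTop, ∀ S : ℕ, reg.L k ≤ S → ∀ (f : Fin Nf) (n : ℕ), n ≤ S →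
      ∫⁻ U : GaugeConfig 4 (2 * S + 1) SU3,
          ENNReal.ofReal ‖(diracMatrix U fun fl => reg.mcrit k + reg.a k * m fl / reg.Zm k).det‖ *
            ENNReal.ofReal (∑ a : Fin 3, ∑ i : Fin 4, ∑ b : Fin 3, ∑ j : Fin 4,
              ‖(diracMatrix U fun fl => reg.mcrit k + reg.a k * m fl / reg.Zm k)⁻¹
                (quarkEquiv (f, (Torus.proj (2 * S + 1) 0, a, i)))
                (quarkEquiv (f, (Torus.proj (2 * S + 1) (Pi.single 0 (n : ℤ)), b, j)))‖) ^ (-r)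
          ∂(wilsonMeasure (fundamentalRep (Fin 3)) (reg.β k)) ≤
        ENNReal.ofReal (c * (1 + |reg.β k|) ^ P * Real.exp (r * (C₁ * (reg.a k * n) + p * Real.log (n + 1)))) *
          ∫⁻ U : GaugeConfig 4 (2 * S + 1) SU3,
            ENNReal.ofReal ‖(diracMatrix U fun fl => reg.mcrit k + reg.a k * m fl / reg.Zm k).det‖
            ∂(wilsonMeasure (fundamentalRep (Fin 3)) (reg.β k))) →
    ∀ κ s : ℝ, 0 < κ → 0 < s → s < 1 → ∃ c₀ C₁ p : ℝ, 0 < c₀ ∧ ∀ᶠ k in atTop, ∀ S : ℕ, reg.L k ≤ S →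
      ∀ (f : Fin Nf) (n : ℕ), n ≤ S → (1 + |reg.β k|) ^ κ ≤ (n : ℝ) + 1 →
        c₀ * Real.exp (-(C₁ * (reg.a k * n) + p * Real.log (n + 1))) ≤ (∫ U : GaugeConfig 4 (2 * S + 1) (Matrix.specialUnitaryGroup (Fin 3) ℂ), ‖(diracMatrix U fun fl => reg.mcrit k + reg.a k * m fl / reg.Zm k).det‖ * (∑ a : Fin 3, ∑ i : Fin 4, ∑ b : Fin 3, ∑ j : Fin 4, ‖(diracMatrix U fun fl => reg.mcrit k + reg.a k * m fl / reg.Zm k)⁻¹ (quarkEquiv (f, (Torus.proj (2 * S + 1) 0, a, i))) (quarkEquiv (f, (Torus.proj (2 * S + 1) (Pi.single 0 (n : ℤ)), b, j)))‖) ^ s ∂(wilsonMeasure (fundamentalRep (Fin 3)) (reg.β k))) / (∫ U : GaugeConfig 4 (2 * S + 1) (Matrix.specialUnitaryGroup (Fin 3) ℂ), ‖(diracMatrix U fun fl => reg.mcrit k + reg.a k * m fl / reg.Zm k).det‖ ∂(wilsonMeasure (fundamentalRep (Fin 3)) (reg.β k)))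

/-- Text of `stub_harmonicTrajectory` (A, the physics stub; line-local vocabulary allowed — never landed alone). -/
abbrev stub_harmonicTrajectory : Prop :=
  ∀ Nf : ℕ, Nf = 2 ∨ Nf = 3 → ∃ reg : QCDRegularisation Nf, reg.HasMassScaling ∧
    (reg.scheme 0 0 0).HasAsymptoticScaling ∧ ∀ m : Fin Nf → ℝ, (∀ f, 0 < m f) →
      ClauseI reg m ∧ OneScale reg m ∧ ClauseIV reg m ∧ Admissible reg m ∧ UVPin reg m ∧
        NoDeepFades reg m

/-- Text of `stub_fibreGlue` (the lead's assembly stub): the two fibre modules give the delocalisation. -/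
abbrev stub_fibreGlue : Prop :=
  stub_adjugateSmallBall → stub_resampling → stub_fibreDominate →
    ∀ (Nf : ℕ) (reg : QCDRegularisation Nf) (m : Fin Nf → ℝ),
      Admissible reg m → NoDeepFades reg m → HarmonicPin reg m

end Registered

/-! ### §0e Bridges: the tree-vocabulary texts ARE the line's packaged statements (definitional) -/

section Bridges

variable {Nf : ℕ}

/-- D's hypothesis is `HarmonicPin` and its conclusion is `FarPin` (definitional unfolding). -/
theorem sandwich_iff :
    Registered.stub_powerMeanSandwich ↔
      ∀ (Nf : ℕ) (reg : QCDRegularisation Nf) (m : Fin Nf → ℝ), HarmonicPin reg m → FarPin reg m :=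
  Iff.rfl

end Bridges

/-! ### §1 Registered stubs -/

/-- **Stub A — THE HARMONIC TRAJECTORY (the physics; HARDEST; open problem; held by the lead).**  For
`N_f ∈ {2,3}` there is ONE mass-independent AF Wilson regularisation (`HasMassScaling`, two-loop
`HasAsymptoticScaling`) such that for every `m > 0`, along `m_f(k) = m_crit(k) + a_k m_f/Z_m(k)`: the companion
clauses (i), (one-scale), (iv) of the crux hold VERBATIM; the trajectory is `Admissible`; the UV honesty pin
`UVPin` holds; and the fibre-smoothed quark propagator has `NoDeepFades`.  This is the crux with its lower pin
(iii) TRADED for (UV honesty) + (no deep fades of `𝒮_f`) — it carries everything open about the trajectory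
((iv) at `N_f = 3`; the one-scale input = localisation of in-gap modes of `γ₅ D_W` along an AF trajectory; a
YM-UV slice) and is at least crux-sized (triage r1-2: NDF ⊋ (iii)).  Sources: arXiv:1106.0073, arXiv:1204.4664,
GoltermanShamir2003, SharpeSingleton1998, MontvayMunster1994 §5.1. -/
theorem stub_harmonicTrajectory :
    ∀ Nf : ℕ, Nf = 2 ∨ Nf = 3 → ∃ reg : QCDRegularisation Nf, reg.HasMassScaling ∧
      (reg.scheme 0 0 0).HasAsymptoticScaling ∧ ∀ m : Fin Nf → ℝ, (∀ f, 0 < m f) →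
        ClauseI reg m ∧ OneScale reg m ∧ ClauseIV reg m ∧ Admissible reg m ∧ UVPin reg m ∧
          NoDeepFades reg m := by
  sorry

/-! **Stub B — ADJUGATE FIBRE SMALL BALLS: LANDED** (p103786, wave 1) as
`Summit.QuantumFields.QCD.Theorems.AdjugateAnticoncentrationPin.stub_adjugateSmallBall`
(`Theorems/PauliWegnerSeaOneScaleTrajectoryStubAdjugateSmallBall.lean`, imported above); its registered text is `Registered.stub_adjugateSmallBall` (§0d), inhabited below. -/

/-- The landed module inhabits its registered text (syntactically the same statement). -/
theorem stub_adjugateSmallBall_holds : Registered.stub_adjugateSmallBall :=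
  Summit.QuantumFields.QCD.Theorems.AdjugateAnticoncentrationPin.stub_adjugateSmallBall

/-! **Stub B-aux — ADJUGATE BAND LIMIT: LANDED** (p98614, wave 1) as
`Summit.QuantumFields.QCD.Theorems.AdjugateAnticoncentrationPin.stub_adjugateBandLimit`
(`Theorems/PauliWegnerSeaOneScaleTrajectoryStubAdjugateBandLimit.lean`, imported above; consumed by stub B's proof). -/

/-! **Stub C1 — RESAMPLING IDENTITY: LANDED** (p106163, wave 1) as
`Summit.QuantumFields.QCD.Theorems.AdjugateAnticoncentrationPin.stub_resampling`
(`Theorems/PauliWegnerSeaOneScaleTrajectoryStubResampling.lean`, imported above); its registered text is `Registered.stub_resampling` (§0d), inhabited below. -/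

/-- The landed module inhabits its registered text (syntactically the same statement). -/
theorem stub_resampling_holds : Registered.stub_resampling :=
  Summit.QuantumFields.QCD.Theorems.AdjugateAnticoncentrationPin.stub_resampling

/-! **Stub C2 — FIBRE DOMINATION: LANDED** (p111669 (+ Literature/MeasureTheory/Integral/SmallBallNegativeMoments.lean p107379), wave 1) as
`Summit.QuantumFields.QCD.Theorems.AdjugateAnticoncentrationPin.stub_fibreDominate`
(`Theorems/PauliWegnerSeaOneScaleTrajectoryStubFibreDominate.lean`, imported above); its registered text is `Registered.stub_fibreDominate` (§0d), inhabited below. -/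

/-- The landed module inhabits its registered text (syntactically the same statement). -/
theorem stub_fibreDominate_holds : Registered.stub_fibreDominate :=
  Summit.QuantumFields.QCD.Theorems.AdjugateAnticoncentrationPin.stub_fibreDominate

/-! ### §1b Glue lemmas for stub C-glue (sorry-free): fibre algebra of `refit`, measurability of the
fibre-smoothed scale, and the abstract delocalisation inequality -/

section GlueLemmas

variable {Nf : ℕ}

/-- Refitting twice on the same two stars keeps only the last fibre coordinate: the outside of
`refit x y U W` is the outside of `U`. -/
theorem refit_refit {N : ℕ} (x y : TorusSite 4 N) (U W W' : GaugeConfig 4 N SU3) :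
    refit x y (refit x y U W) W' = refit x y U W' := by
  funext e
  by_cases h : e.1 = x ∨ Site.shift e.1 e.2 = x ∨ e.1 = y ∨ Site.shift e.1 e.2 = y
  · simp [refit, h]
  · simp [refit, h]

/-- The tilted fibre weight depends on `U` only through its outside. -/
theorem fibreWt_refit (β : ℝ) {N : ℕ} [NeZero N] (x y : TorusSite 4 N)
    (U W W' : GaugeConfig 4 N SU3) : fibreWt β x y (refit x y U W) W' = fibreWt β x y U W' := by
  simp only [fibreWt, refit_refit]

/-- The tilted fibre mean depends on `U` only through its outside. -/
theorem tMean_refit (β : ℝ) {N : ℕ} [NeZero N] (x y : TorusSite 4 N) (U W : GaugeConfig 4 N SU3)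
    (Φ : GaugeConfig 4 N SU3 → ℝ) : tMean β x y (refit x y U W) Φ = tMean β x y U Φ := by
  simp only [tMean, fibreWt_refit, refit_refit]

/-- **The fibre-smoothed scale is fibre-constant**: `𝒮(refit_U W) = 𝒮(U)`. -/
theorem fibreScale_refit (β : ℝ) {N : ℕ} [NeZero N] (x y : TorusSite 4 N)
    (U W : GaugeConfig 4 N SU3) (m₀ : ℝ) :
    fibreScale β (refit x y U W) m₀ x y = fibreScale β U m₀ x y := by
  simp only [fibreScale, tMean_refit]

/-- The Wilson action of `SU(3)` on the four-torus is continuous in the configuration. -/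
theorem continuous_wilsonAction_su3 {N : ℕ} [NeZero N] :
    Continuous fun V : GaugeConfig 4 N SU3 => wilsonAction (fundamentalRep (Fin 3)) V := by
  unfold wilsonAction
  refine continuous_finsetSum _ fun p _ => continuous_const.sub ?_
  refine Complex.continuous_re.comp (((continuous_fundamentalRep (Fin 3)).comp ?_).matrix_trace)
  unfold plaquetteHolonomy
  fun_prop

/-- `refit x y U` is continuous in the fibre coordinate. -/
theorem continuous_refit {N : ℕ} (x y : TorusSite 4 N) (U : GaugeConfig 4 N SU3) :
    Continuous (refit x y U) := by
  refine continuous_pi fun e => ?_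
  simp only [refit]
  split_ifs
  · exact continuous_apply e
  · exact continuous_const

/-- `refit x y` is jointly continuous in (outside, fibre coordinate). -/
theorem continuous_refit₂ {N : ℕ} (x y : TorusSite 4 N) :
    Continuous fun p : GaugeConfig 4 N SU3 × GaugeConfig 4 N SU3 => refit x y p.1 p.2 := by
  refine continuous_pi fun e => ?_
  simp only [refit]
  split_ifs
  · exact (continuous_apply e).comp continuous_snd
  · exact (continuous_apply e).comp continuous_fst

/-- The tilted fibre weight is jointly continuous in (outside, fibre coordinate). -/
theorem continuous_fibreWt₂ (β : ℝ) {N : ℕ} [NeZero N] (x y : TorusSite 4 N) :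
    Continuous fun p : GaugeConfig 4 N SU3 × GaugeConfig 4 N SU3 => fibreWt β x y p.1 p.2 := by
  unfold fibreWt
  exact Real.continuous_exp.comp
    ((continuous_wilsonAction_su3.comp (continuous_refit₂ x y)).const_mul β).neg

/-- The `ℓ¹` adjugate block is continuous in the configuration. -/
theorem continuous_adjBlock {N : ℕ} [NeZero N] (m₀ : ℝ) (x y : TorusSite 4 N) :
    Continuous fun V : GaugeConfig 4 N SU3 => adjBlock V m₀ x y := by
  unfold adjBlock
  refine continuous_finsetSum _ fun a _ => continuous_finsetSum _ fun i _ =>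
    continuous_finsetSum _ fun b _ => continuous_finsetSum _ fun j _ => ?_
  exact (((continuous_wilsonDirac (fundamentalRep (Fin 3)) (continuous_fundamentalRep (Fin 3))
    m₀ 1).matrix_adjugate).matrix_elem _ _).norm

/-- `|det D_W(·; m₀)|` is continuous in the configuration. -/
theorem continuous_detAbs {N : ℕ} [NeZero N] (m₀ : ℝ) :
    Continuous fun V : GaugeConfig 4 N SU3 => detAbs V m₀ := by
  unfold detAbs
  exact ((continuous_wilsonDirac (fundamentalRep (Fin 3)) (continuous_fundamentalRep (Fin 3))
    m₀ 1).matrix_det).norm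

/-- Product Haar on the links of the torus is a probability measure. -/
instance isProbabilityMeasure_haarCfg (N : ℕ) [NeZero N] : IsProbabilityMeasure (haarCfg N) := by
  unfold haarCfg
  infer_instance

/-- A jointly continuous integrand has a continuous fibre integral against product Haar (compact
configuration space, finite measure: dominated convergence). -/
theorem continuous_integral_haarCfg {N : ℕ} [NeZero N]
    {F : GaugeConfig 4 N SU3 → GaugeConfig 4 N SU3 → ℝ}
    (hF : Continuous fun p : GaugeConfig 4 N SU3 × GaugeConfig 4 N SU3 => F p.1 p.2) :
    Continuous fun U => ∫ W, F U W ∂(haarCfg N) := by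
  have h := continuous_parametric_integral_of_continuous (μ := haarCfg N) (f := F) hF
    isCompact_univ
  simpa only [Measure.restrict_univ] using h

/-- The tilted fibre mean of a continuous amplitude is measurable in the outside configuration. -/
theorem measurable_tMean (β : ℝ) {N : ℕ} [NeZero N] (x y : TorusSite 4 N)
    {Φ : GaugeConfig 4 N SU3 → ℝ} (hΦ : Continuous Φ) :
    Measurable fun U => tMean β x y U Φ := by
  unfold tMean
  refine (continuous_integral_haarCfg ?_).measurable.div (continuous_integral_haarCfg ?_).measurable
  · exact (hΦ.comp (continuous_refit₂ x y)).mul (continuous_fibreWt₂ β x y)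
  · exact continuous_fibreWt₂ β x y

/-- **The fibre-smoothed scale `𝒮` is a measurable function of the configuration** (a ratio of
parametric integrals of jointly continuous integrands). -/
theorem measurable_fibreScale (β : ℝ) {N : ℕ} [NeZero N] (m₀ : ℝ) (x y : TorusSite 4 N) :
    Measurable fun U : GaugeConfig 4 N SU3 => fibreScale β U m₀ x y := by
  unfold fibreScale
  exact (measurable_tMean β x y (continuous_adjBlock m₀ x y)).div
    (measurable_tMean β x y (continuous_detAbs m₀))

/-- **Abstract delocalisation.** If integration against `μ` factors through the fibres `ρ U ·` with
weight `w` (the resampling identity `hres` for measurable integrands), and the fibre integrals of an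
integrand `d · g` are dominated by `c · s(U) ·` (fibre integral of `d`) with `s` fibre-constant,
then `∫ d g dμ ≤ c ∫ d s dμ` (resample, dominate fibrewise, pull the fibre constant out, resample
back). -/
theorem lintegral_mul_le_of_fibre {α γ : Type*} [MeasurableSpace α] [MeasurableSpace γ]
    (μ : Measure α) (π : Measure γ) (ρ : α → γ → α) (w d g s : α → ℝ≥0∞) {c : ℝ≥0∞} (hc : c ≠ ∞)
    (hres : ∀ Φ : α → ℝ≥0∞, Measurable Φ →
      ∫⁻ U, Φ U ∂μ = ∫⁻ U, (∫⁻ W, Φ (ρ U W) * w (ρ U W) ∂π) / (∫⁻ W, w (ρ U W) ∂π) ∂μ)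
    (hdg : Measurable fun U => d U * g U) (hds : Measurable fun U => d U * s U)
    (hdw : ∀ U, Measurable fun W => d (ρ U W) * w (ρ U W)) (hs : ∀ U W, s (ρ U W) = s U)
    (hdom : ∀ U, ∫⁻ W, d (ρ U W) * g (ρ U W) * w (ρ U W) ∂π ≤
      c * s U * ∫⁻ W, d (ρ U W) * w (ρ U W) ∂π) :
    ∫⁻ U, d U * g U ∂μ ≤ c * ∫⁻ U, d U * s U ∂μ := by
  have h1 : ∫⁻ U, d U * g U ∂μ =
      ∫⁻ U, (∫⁻ W, d (ρ U W) * g (ρ U W) * w (ρ U W) ∂π) / (∫⁻ W, w (ρ U W) ∂π) ∂μ :=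
    hres _ hdg
  have h2 : ∫⁻ U, d U * s U ∂μ =
      ∫⁻ U, (∫⁻ W, d (ρ U W) * s (ρ U W) * w (ρ U W) ∂π) / (∫⁻ W, w (ρ U W) ∂π) ∂μ :=
    hres _ hds
  have key : ∀ U, ∫⁻ W, d (ρ U W) * s (ρ U W) * w (ρ U W) ∂π =
      s U * ∫⁻ W, d (ρ U W) * w (ρ U W) ∂π := fun U => by
    rw [← lintegral_const_mul _ (hdw U)]
    exact lintegral_congr fun W => by rw [hs]; ring
  rw [h1, h2, ← lintegral_const_mul' c _ hc]
  refine lintegral_mono fun U => ?_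
  calc (∫⁻ W, d (ρ U W) * g (ρ U W) * w (ρ U W) ∂π) / ∫⁻ W, w (ρ U W) ∂π
      ≤ (c * s U * ∫⁻ W, d (ρ U W) * w (ρ U W) ∂π) / ∫⁻ W, w (ρ U W) ∂π :=
        ENNReal.div_le_div_right (hdom U) _
    _ = c * ((∫⁻ W, d (ρ U W) * s (ρ U W) * w (ρ U W) ∂π) / ∫⁻ W, w (ρ U W) ∂π) := by
        rw [key U, mul_assoc, mul_div_assoc]

/-- **Delocalisation onto the fibre-smoothed scale** (C1 forward, C2 on each two-star fibre, the
fibre constant `𝒮^{-r}` pulled out, C1 backward): if on every fibre the tilted mean of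
`|det D| X_f^{-r}` is at most `C(1+β)^P 𝒮_f^{-r}` times that of `|det D|`, then
`∫ |det D| X_f^{-r} dμ_W ≤ C(1+β)^P ∫ |det D| 𝒮_f^{-r} dμ_W`. -/
theorem lintegral_propBlock_le (hC1 : Registered.stub_resampling) {N : ℕ} [NeZero N]
    {β r C P : ℝ} (mq : Fin Nf → ℝ) (x y : TorusSite 4 N) (f : Fin Nf)
    (hdom : ∀ U : GaugeConfig 4 N SU3,
      ∫⁻ W, ENNReal.ofReal ‖(diracMatrix (refit x y U W) mq).det‖ *
          ENNReal.ofReal (∑ a : Fin 3, ∑ i : Fin 4, ∑ b : Fin 3, ∑ j : Fin 4,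
            ‖(diracMatrix (refit x y U W) mq)⁻¹ (quarkEquiv (f, (x, a, i)))
              (quarkEquiv (f, (y, b, j)))‖) ^ (-r) *
          ENNReal.ofReal (fibreWt β x y U W) ∂(haarCfg N) ≤
        ENNReal.ofReal (C * (1 + β) ^ P) * ENNReal.ofReal (fibreScale β U (mq f) x y) ^ (-r) *
          ∫⁻ W, ENNReal.ofReal ‖(diracMatrix (refit x y U W) mq).det‖ *
            ENNReal.ofReal (fibreWt β x y U W) ∂(haarCfg N)) :
    ∫⁻ U, ENNReal.ofReal ‖(diracMatrix U mq).det‖ *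
        ENNReal.ofReal (∑ a : Fin 3, ∑ i : Fin 4, ∑ b : Fin 3, ∑ j : Fin 4,
          ‖(diracMatrix U mq)⁻¹ (quarkEquiv (f, (x, a, i))) (quarkEquiv (f, (y, b, j)))‖) ^ (-r)
        ∂(wilsonMeasure (fundamentalRep (Fin 3)) β) ≤
      ENNReal.ofReal (C * (1 + β) ^ P) *
        ∫⁻ U, ENNReal.ofReal ‖(diracMatrix U mq).det‖ *
            ENNReal.ofReal (fibreScale β U (mq f) x y) ^ (-r)
          ∂(wilsonMeasure (fundamentalRep (Fin 3)) β) := by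
  have hX : Measurable fun U : GaugeConfig 4 N SU3 => ∑ a : Fin 3, ∑ i : Fin 4, ∑ b : Fin 3,
      ∑ j : Fin 4, ‖(diracMatrix U mq)⁻¹ (quarkEquiv (f, (x, a, i)))
        (quarkEquiv (f, (y, b, j)))‖ := by
    refine Finset.measurable_sum _ fun a _ => Finset.measurable_sum _ fun i _ =>
      Finset.measurable_sum _ fun b _ => Finset.measurable_sum _ fun j _ => ?_
    exact (measurable_inv_diracMatrix_apply mq _ _).norm
  have hdet : Measurable fun U : GaugeConfig 4 N SU3 => ENNReal.ofReal ‖(diracMatrix U mq).det‖ :=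
    (measurable_norm_det_diracMatrix mq).ennreal_ofReal
  refine lintegral_mul_le_of_fibre (wilsonMeasure (fundamentalRep (Fin 3)) β) (haarCfg N)
    (refit x y) (fun V => ENNReal.ofReal (Real.exp (-(β * wilsonAction (fundamentalRep (Fin 3)) V))))
    (fun V => ENNReal.ofReal ‖(diracMatrix V mq).det‖)
    (fun V => ENNReal.ofReal (∑ a : Fin 3, ∑ i : Fin 4, ∑ b : Fin 3, ∑ j : Fin 4,
      ‖(diracMatrix V mq)⁻¹ (quarkEquiv (f, (x, a, i))) (quarkEquiv (f, (y, b, j)))‖) ^ (-r))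
    (fun V => ENNReal.ofReal (fibreScale β V (mq f) x y) ^ (-r))
    ENNReal.ofReal_ne_top ?_ ?_ ?_ ?_ ?_ ?_
  · -- C1: the resampling identity on the two stars `star(x) ∪ star(y)`
    intro Φ hΦ
    exact hC1 N β (fun e => e.1 = x ∨ Site.shift e.1 e.2 = x ∨ e.1 = y ∨ Site.shift e.1 e.2 = y)
      Φ hΦ
  · exact hdet.mul (hX.ennreal_ofReal.pow_const _)
  · exact hdet.mul ((measurable_fibreScale β (mq f) x y).ennreal_ofReal.pow_const _)
  · intro U
    have hρ : Continuous (refit x y U) := continuous_refit x y U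
    exact ((measurable_norm_det_diracMatrix mq).comp hρ.measurable).ennreal_ofReal.mul
      ((continuous_wilsonAction_su3.comp hρ).measurable.const_mul β).neg.exp.ennreal_ofReal
  · intro U W
    simp only [fibreScale_refit]
  · intro U
    exact hdom U

end GlueLemmas

/-- **Stub C-glue — FIBRE DELOCALISATION ASSEMBLED** (the lead's; size M; line-local vocabulary).  From B, C1
and C2: for `k` late (`β_k ≥ 0`, masses in `[-2,2]` by `Admissible`, side `2S+1 ≥ 5`), `r := min r₀ r₁`,
apply C1 to `Φ = |det D| X_f^{-r}`, bound each fibre by C2, pull the fibre-constant `𝒮_f^{-r}` out, and apply C1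
backwards to `Φ' = |det D| 𝒮_f^{-r}` (`𝒮_f ∘ refit_U = 𝒮_f(U)`): `pqHarmonic ≤ C(1+β_k)^P pqFibreHarmonic`;
then `NoDeepFades` at `r`. -/
theorem stub_fibreGlue :
    Registered.stub_adjugateSmallBall → Registered.stub_resampling → Registered.stub_fibreDominate →
      ∀ (Nf : ℕ) (reg : QCDRegularisation Nf) (m : Fin Nf → ℝ),
        Admissible reg m → NoDeepFades reg m → HarmonicPin reg m := by
  intro hB hC1 hC2 Nf reg m hAdm hNDF
  obtain ⟨hβev, hmassev⟩ := hAdm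
  obtain ⟨r₀, hr₀, hNDF⟩ := hNDF
  obtain ⟨r₁, hr₁, hC2⟩ := hC2 hB Nf
  have hr : 0 < min r₀ r₁ := lt_min hr₀ hr₁
  obtain ⟨C, P, hC, hdomC⟩ := hC2 (min r₀ r₁) hr (min_le_right _ _)
  obtain ⟨c, C₁, p, hc, hNDFr⟩ := hNDF (min r₀ r₁) hr (min_le_left _ _)
  refine ⟨min r₀ r₁, P, C * c, C₁, p, hr, mul_pos hC hc, ?_⟩
  have ha1 : ∀ᶠ k in atTop, reg.a k < 1 := reg.tendsto_a.eventually_lt_const zero_lt_one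
  have haL : ∀ᶠ k in atTop, (2 : ℝ) ≤ reg.a k * reg.L k := reg.tendsto_L.eventually_ge_atTop 2
  filter_upwards [hβev, eventually_all.2 hmassev, ha1, haL, hNDFr] with k hβ hmass ha hL hk S hS f
    n hn
  -- the torus side is `2S+1 ≥ 5 ≥ 4` (`a_k L_k ≥ 2`, `a_k ≤ 1`)
  have hL2 : (2 : ℝ) ≤ reg.L k := by
    have h1 : reg.a k * reg.L k ≤ 1 * reg.L k :=
      mul_le_mul_of_nonneg_right ha.le (Nat.cast_nonneg _)
    linarith
  have hL2' : 2 ≤ reg.L k := by exact_mod_cast hL2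
  have hN : 4 ≤ 2 * S + 1 := by omega
  -- C1 + C2 + C1: delocalisation of `X_f^{-r}` onto `𝒮_f^{-r}`
  have hmain : pqHarmonic reg m k S f n (min r₀ r₁) ≤
      ENNReal.ofReal (C * (1 + reg.β k) ^ P) * pqFibreHarmonic reg m k S f n (min r₀ r₁) :=
    lintegral_propBlock_le hC1 (bare reg m k) (Torus.proj (2 * S + 1) 0)
      (Torus.proj (2 * S + 1) (Pi.single 0 (n : ℤ))) f fun U =>
      hdomC (reg.β k) hβ (bare reg m k) hmass (2 * S + 1) hN U (Torus.proj (2 * S + 1) 0)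
        (Torus.proj (2 * S + 1) (Pi.single 0 (n : ℤ))) f
        (refit (Torus.proj (2 * S + 1) 0) (Torus.proj (2 * S + 1) (Pi.single 0 (n : ℤ))) U)
        (fun W e => rfl)
        (fibreWt (reg.β k) (Torus.proj (2 * S + 1) 0)
          (Torus.proj (2 * S + 1) (Pi.single 0 (n : ℤ))) U)
        (fun W => rfl) (haarCfg (2 * S + 1)) rfl
  -- `NoDeepFades` at `r`, and the constants
  have hpos : 0 ≤ C * (1 + reg.β k) ^ P := by positivity
  calc pqHarmonic reg m k S f n (min r₀ r₁)
      ≤ ENNReal.ofReal (C * (1 + reg.β k) ^ P) * pqFibreHarmonic reg m k S f n (min r₀ r₁) := hmain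
    _ ≤ ENNReal.ofReal (C * (1 + reg.β k) ^ P) *
          (ENNReal.ofReal (c * Real.exp (min r₀ r₁ * (C₁ * (reg.a k * n) + p * Real.log (n + 1)))) *
            pqWeight reg m k S) := mul_le_mul_right (hk S hS f n hn) _
    _ = ENNReal.ofReal (C * c * (1 + |reg.β k|) ^ P *
          Real.exp (min r₀ r₁ * (C₁ * (reg.a k * n) + p * Real.log (n + 1)))) *
          pqWeight reg m k S := by
        rw [← mul_assoc, ← ENNReal.ofReal_mul hpos, abs_of_nonneg hβ]
        congr 2
        ring

/-! **Stub D — THE POWER-MEAN SANDWICH: LANDED** (p112936 (+ Literature/MeasureTheory/Integral/WeightedLyapunovNegativeMoment.lean p112057), wave 1) as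
`Summit.QuantumFields.QCD.Theorems.AdjugateAnticoncentrationPin.stub_powerMeanSandwich`
(`Theorems/PauliWegnerSeaOneScaleTrajectoryStubPowerMeanSandwich.lean`, imported above); its registered text is `Registered.stub_powerMeanSandwich` (§0d), inhabited below. -/

/-- The landed module inhabits its registered text (syntactically the same statement). -/
theorem stub_powerMeanSandwich_holds : Registered.stub_powerMeanSandwich :=
  Summit.QuantumFields.QCD.Theorems.AdjugateAnticoncentrationPin.stub_powerMeanSandwich

/-! ### §2 Sorry-free glue: the distance split of clause (iii) -/

section Glue

variable {Nf : ℕ}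

/-- Monotonicity of the envelope `c e^{-(C a + p L)}` in its constants (`a, L ≥ 0`). -/
theorem envelope_mono {c c' C C' p p' a L : ℝ} (hc' : 0 ≤ c') (hcc : c' ≤ c) (hC : C ≤ C') (hp : p ≤ p')
    (ha : 0 ≤ a) (hL : 0 ≤ L) :
    c' * Real.exp (-(C' * a + p' * L)) ≤ c * Real.exp (-(C * a + p * L)) := by
  refine mul_le_mul hcc ?_ (Real.exp_pos _).le (hc'.trans hcc)
  refine Real.exp_le_exp.mpr (neg_le_neg ?_)
  exact add_le_add (mul_le_mul_of_nonneg_right hC ha) (mul_le_mul_of_nonneg_right hp hL)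

/-- **Clause (iii) from its two halves** (sorry-free). -/
theorem clauseIII_of_pins (reg : QCDRegularisation Nf) (m : Fin Nf → ℝ) (hUV : UVPin reg m)
    (hFar : FarPin reg m) : ClauseIII reg m := by
  obtain ⟨κ, s, c₀, C₁, p, hκ, hs, hs1, hc₀, hUV⟩ := hUV
  obtain ⟨c₀', C₁', p', hc₀', hFar⟩ := hFar κ s hκ hs hs1
  refine ⟨s, min c₀ c₀', max C₁ C₁', max p p', hs, hs1, lt_min hc₀ hc₀', ?_⟩
  filter_upwards [hUV, hFar] with k hk hk' S hS f n hn
  have ha : 0 ≤ reg.a k * (n : ℝ) := mul_nonneg (reg.a_pos k).le (Nat.cast_nonneg n)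
  have hL : 0 ≤ Real.log ((n : ℝ) + 1) := Real.log_nonneg (le_add_of_nonneg_left (Nat.cast_nonneg n))
  have hmin : 0 ≤ min c₀ c₀' := (lt_min hc₀ hc₀').le
  by_cases hlt : (n : ℝ) + 1 < (1 + |reg.β k|) ^ κ
  · exact (envelope_mono hmin (min_le_left _ _) (le_max_left _ _) (le_max_left _ _) ha hL).trans
      (hk S hS f n hn hlt)
  · exact (envelope_mono hmin (min_le_right _ _) (le_max_right _ _) (le_max_right _ _) ha hL).trans
      (hk' S hS f n hn (not_lt.mp hlt))

end Glue

/-! ### §3 Composition (no `sorry` below this line) -/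

/-- **THE LINE'S TRANSFER AS A THEOREM (sorry-free given the landed modules):** for EVERY regularisation and EVERY
mass tuple, clause (iii) of the crux follows from the bookkeeping `Admissible`, the physics input `NoDeepFades`
(negative moments of the fibre-smoothed quark propagator) and the UV honesty pin — B, C1, C2, D and the glue do the rest.
This is the statement a planner can splice into any other line that constructs a witness `reg` (e.g. the threshold
line's `thrMass` witness): its lower-pin obligation (iii) reduces to `UVPin ∧ NoDeepFades` at that witness. -/
theorem clauseIII_of_noDeepFades {Nf : ℕ} (reg : QCDRegularisation Nf) (m : Fin Nf → ℝ) (hAdm : Admissible reg m)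
    (hNDF : NoDeepFades reg m) (hUV : UVPin reg m) : ClauseIII reg m :=
  clauseIII_of_pins reg m hUV (sandwich_iff.mp stub_powerMeanSandwich_holds Nf reg m
    (stub_fibreGlue stub_adjugateSmallBall_holds stub_resampling_holds stub_fibreDominate_holds Nf reg m hAdm hNDF))

/-- **`OneScaleTrajectory` from the ONE remaining registered stub (A) and the four landed modules** (kernel-checked, no
`sorry` of its own; hypothesis by name): A supplies the witness with (i), (one-scale), (iv), `Admissible`, `UVPin`,
`NoDeepFades`; the LANDED fibre modules B, C1, C2 assembled by the in-file glue (`stub_fibreGlue`, proved) turn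
`NoDeepFades` into `HarmonicPin`; the LANDED sandwich D turns that into `FarPin`; `clauseIII_of_pins` glues the UV pin and
the far pin into clause (iii). -/
theorem OneScaleTrajectory_of (hA : Registered.stub_harmonicTrajectory) :
    Summit.QuantumFields.QCD.Theses.PauliWegnerSea.OneScaleTrajectory := by
  have hD' := sandwich_iff.mp stub_powerMeanSandwich_holds
  refine crux_iff.mpr ?_
  intro Nf hNf
  obtain ⟨reg, hMS, hAS, h⟩ := hA Nf hNf
  refine ⟨reg, hMS, hAS, fun m hm => ?_⟩
  obtain ⟨hI, hOS, hIV, hAdm, hUV, hNDF⟩ := h m hm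
  exact ⟨hI, hOS,
    clauseIII_of_pins reg m hUV (hD' Nf reg m
      (stub_fibreGlue stub_adjugateSmallBall_holds stub_resampling_holds stub_fibreDominate_holds
        Nf reg m hAdm hNDF)), hIV⟩

/-- Wiring check: the ONE remaining registered stub (A, the physics) feeds the composition as stated; the crux modulo
that single `sorry`, the four LANDED modules B, C1, C2, D, the in-file glue, and nothing else. -/
example : Summit.QuantumFields.QCD.Theses.PauliWegnerSea.OneScaleTrajectory :=
  OneScaleTrajectory_of stub_harmonicTrajectory

end Summit.QuantumFields.QCD.Cruxes.OneScaleTrajectory.AdjugateAnticoncentrationPin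

end
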